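import Literature.Probability.Percolation.SelfRefinementMeasure
import Literature.Probability.Percolation.KSTPeriodicWeak
import Literature.Probability.Percolation.KSTPeriodicDualMeasure

/-!
# From the weak periodic RSW theorem to box-crossing bounds, part 2a: the dual measure and its short-way crossings

Support file for item `stmt-CriticalPhenomena-10267` (route `CardySelfRefinement`, crux
`CriticalPathRSW`, line finite-size-envelope, stub `stub_rswOfCertificates3`).

The law `μ* = M_k(ρ, c) ∘ dualConfig⁻¹` of the planar dual configuration (faces labelled by
lower-left corners, `dualConfig` of `Crossings.lean`) satisfies the standing hypotheses
`KSTPeriodic.Admissible k 1` of the weak periodic Russo–Seymour–Welsh theorem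
(Köhler-Schindler–Tassion, Duke Math. J. 172 (2023), Theorem 1 with Comment 1): `M_k(ρ, c)` is
`Admissible k 0` (invariance under `kℤ²`, the transposition and the reflection `x ↦ (-x₀, x₁)`,
positive association; `SelfRefinementMeasure.lean`) and the dual of an admissible measure is
admissible with offset `t + 1` (`KSTPeriodic.admissible_map_dualConfig`). For ANY admissible
lattice-carried `μ`, a hard-way bound `μ(𝓒(3kn, kn)) ≤ 1 - ε` for `n ≥ n₀` gives, by planar
duality (`lrCrossing_xor_dualTBCrossing_holds`: no primal left–right crossing of
`[0, 6N] × [0, 2N]` forces a dual top–bottom crossing of `[0, 6N - 1] × [-1, 2N]`), after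
transposing and recentring by a vector of `kℤ²`, the dual short-way hypothesis
`μ*(𝓒₁(N, 8N)) ≥ ε` at the scales `N = kn`, `n ≥ n₀` (`RswCertDual.dual_shortWay`).
-/

noncomputable section

namespace Summit.CriticalPhenomena.CardyFormulaZ2.Cruxes.CriticalPathRSW.FiniteSizeEnvelope

open Set MeasureTheory Filter Topology
open Literature.Probability.LatticeModels Literature.Probability.Percolation

namespace RswCertDual

/-! ### Bookkeeping: rectangles, shifts, inclusions on lattice configurations -/

/-- The tree's `LR(m, n)` is `lrRect 0 m 0 n`. -/
theorem lrCrossing_eq_lrRect (m n : ℕ) : lrCrossing m n = KSTPeriodic.lrRect 0 m 0 n := by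
  have hR : (↑(rectangle m n) : Set (Site 2)) = KSTPeriodic.rect 0 m 0 n := by
    ext x
    simp only [Finset.mem_coe, mem_rectangle_iff, KSTPeriodic.mem_rect]
  rw [lrCrossing, leftSide, rightSide, Finset.coe_filter, Finset.coe_filter, KSTPeriodic.lrRect, ← hR]
  rfl

/-- The tree's dual crossing `TB*(m, n)` is the `dualConfig`-preimage of `tbRect 0 (m - 1) (-1) n`. -/
theorem dualTBCrossing_eq_preimage_tbRect (m n : ℕ) :
    dualTBCrossing m n = dualConfig ⁻¹' KSTPeriodic.tbRect 0 ((m : ℤ) - 1) (-1) n := by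
  have hR : (↑(dualRectangle m n) : Set (Site 2)) = KSTPeriodic.rect 0 ((m : ℤ) - 1) (-1) n := by
    ext x
    simp only [Finset.mem_coe, mem_dualRectangle_iff, KSTPeriodic.mem_rect]
  have hT : (↑(dualTopSide m n) : Set (Site 2)) =
      {x | x ∈ KSTPeriodic.rect 0 ((m : ℤ) - 1) (-1) n ∧ x 1 = (n : ℤ)} := by
    ext x
    simp only [Finset.mem_coe, dualTopSide, Finset.mem_filter, mem_dualRectangle_iff,
      KSTPeriodic.mem_rect, Set.mem_setOf_eq]
  have hB : (↑(dualBottomSide m n) : Set (Site 2)) =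
      {x | x ∈ KSTPeriodic.rect 0 ((m : ℤ) - 1) (-1) n ∧ x 1 = -1} := by
    ext x
    simp only [Finset.mem_coe, dualBottomSide, Finset.mem_filter, mem_dualRectangle_iff,
      KSTPeriodic.mem_rect, Set.mem_setOf_eq]
  rw [dualTBCrossing, hR, hT, hB, KSTPeriodic.tbRect, KSTPeriodic.openCrossing_comm]

/-- Translation of rectangle crossings by `kℤ²`, solved form. -/
theorem real_lrRect_shift_eq {k t : ℕ} {μ : Measure (BondConfig (Site 2))} (hμ : KSTPeriodic.Admissible k t μ)
    (v₀ v₁ : ℤ) {a b c d a' b' c' d' : ℤ} (ha : a' = a + k * v₀) (hb : b' = b + k * v₀)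
    (hc : c' = c + k * v₁) (hd : d' = d + k * v₁) :
    μ.real (KSTPeriodic.lrRect a' b' c' d') = μ.real (KSTPeriodic.lrRect a b c d) := by
  subst ha hb hc hd
  simpa using KSTPeriodic.real_lrRect_shift hμ ![v₀, v₁] a b c d

/-- An inclusion valid on lattice configurations gives an inequality of probabilities for a
lattice-carried measure. -/
theorem real_mono_of_latticeCarried {μ : Measure (BondConfig (Site 2))} [IsFiniteMeasure μ]
    (hL : KSTPeriodic.LatticeCarried μ) {A B : Set (BondConfig (Site 2))}
    (h : ∀ ω : BondConfig (Site 2), ω ⊆ (zdGraph 2).edgeSet → ω ∈ A → ω ∈ B) :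
    μ.real A ≤ μ.real B := by
  rw [measureReal_def, measureReal_def]
  exact ENNReal.toReal_mono (measure_ne_top μ B) (measure_mono_ae (hL.mono fun ω hω hA => h ω hω hA))

/-! ### The dual short-way hypothesis from a hard-way bound -/

/-- **Dual short-way crossings from a primal hard-way bound.** For an admissible lattice-carried
probability measure `μ` (offset `t = 0`): if the hard-way crossing `𝓒(3kn, kn)` has
`μ`-probability `≤ 1 - ε` for all `n ≥ n₀`, then the dual law `μ ∘ dualConfig⁻¹` crosses
`R_1(N, 8N)` horizontally with probability `≥ ε` at every scale `N ≥ k n₀` divisible by `k`: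
no primal left–right crossing of `[0, 6N] × [0, 2N]` forces a dual top–bottom crossing of
`[0, 6N - 1] × [-1, 2N]`, i.e. after transposing and recentring a horizontal dual crossing of
`[-N - 1, N] × [-3N, 3N - 1] ⊆ R_1(N, 8N)`. -/
theorem dual_shortWay {k n₀ : ℕ} (hk : 1 ≤ k) {ε : ℝ} {μ : Measure (BondConfig (Site 2))}
    [IsProbabilityMeasure μ] (hμ : KSTPeriodic.Admissible k 0 μ) (hL : KSTPeriodic.LatticeCarried μ)
    (hcert : ∀ n : ℕ, n₀ ≤ n → μ.real (KST2023.crossing (3 * (k * n)) (k * n)) ≤ 1 - ε) :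
    ∀ N : ℕ, k * n₀ ≤ N → k ∣ N →
      ε ≤ (μ.map dualConfig).real (KSTPeriodic.crossing 1 N (8 * N)) := by
  rintro N hN ⟨n, rfl⟩
  have hn : n₀ ≤ n := Nat.le_of_mul_le_mul_left hN (by omega)
  haveI : IsProbabilityMeasure (μ.map dualConfig) := KSTPeriodic.isProbabilityMeasure_map_dualConfig μ
  have hμ' : KSTPeriodic.Admissible k 1 (μ.map dualConfig) := KSTPeriodic.admissible_map_dualConfig hμ
  -- the hard-way bound, recentred to `[0, 6N] × [0, 2N]`
  have h1 : μ.real (KSTPeriodic.lrRect 0 ((6 * (k * n) : ℕ) : ℤ) 0 ((2 * (k * n) : ℕ) : ℤ)) ≤ 1 - ε := by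
    have h := hcert n hn
    rw [← KSTPeriodic.crossing_zero_eq, KSTPeriodic.crossing] at h
    rwa [real_lrRect_shift_eq hμ (3 * n) n (a := -((3 * (k * n) : ℕ) : ℤ) - ((0 : ℕ) : ℤ))
      (b := ((3 * (k * n) : ℕ) : ℤ)) (c := -((k * n : ℕ) : ℤ) - ((0 : ℕ) : ℤ)) (d := ((k * n : ℕ) : ℤ))
      (by push_cast; ring) (by push_cast; ring) (by push_cast; ring) (by push_cast; ring)]
  -- planar duality
  have h2 : ε ≤ (μ.map dualConfig).real
      (KSTPeriodic.tbRect 0 (((6 * (k * n) : ℕ) : ℤ) - 1) (-1) ((2 * (k * n) : ℕ) : ℤ)) := by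
    rw [map_measureReal_apply measurable_dualConfig (KSTPeriodic.measurableSet_tbRect _ _ _ _),
      ← dualTBCrossing_eq_preimage_tbRect]
    have h3 : μ.real (lrCrossing (6 * (k * n)) (2 * (k * n)))ᶜ ≤ μ.real (dualTBCrossing (6 * (k * n)) (2 * (k * n))) :=
      real_mono_of_latticeCarried hL fun ω hω h =>
        (lrCrossing_xor_dualTBCrossing_holds _ _ hω).or.resolve_left h
    rw [probReal_compl_eq_one_sub (s := lrCrossing (6 * (k * n)) (2 * (k * n)))
      (measurableSet_openCrossing_of_countable _ _ _), lrCrossing_eq_lrRect] at h3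
    linarith
  -- transpose, recentre, and enlarge to `R_1(N, 8N)`
  rw [KSTPeriodic.real_tbRect_eq_real_lrRect hμ',
    ← real_lrRect_shift_eq hμ' (-n) (-(3 * n)) (a := -1) (b := ((2 * (k * n) : ℕ) : ℤ)) (c := 0)
      (d := ((6 * (k * n) : ℕ) : ℤ) - 1) (a' := -((k * n : ℕ) : ℤ) - 1) (b' := ((k * n : ℕ) : ℤ))
      (c' := -((3 * (k * n) : ℕ) : ℤ)) (d' := ((3 * (k * n) : ℕ) : ℤ) - 1)
      (by push_cast; ring) (by push_cast; ring) (by push_cast; ring) (by push_cast; ring)] at h2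
  refine h2.trans (real_mono_of_latticeCarried (KSTPeriodic.latticeCarried_map_dualConfig μ) fun ω hω h => ?_)
  simp only [KSTPeriodic.crossing]
  exact KSTPeriodic.lrRect_subset_lrRect hω (by push_cast; omega) (by push_cast; omega)
    (by push_cast; omega) (by push_cast; omega) (by push_cast; omega) h

end RswCertDual

/-- **Headline of this support file** (registered sub-stub `stub_rswOfCertificates3_dualA` of
`stub_rswOfCertificates3`): the dual law `M_k(ρ, c) ∘ dualConfig⁻¹` is `Admissible k 1`, and the
hard-way certificate gives its short-way crossings `𝓒₁(N, 8N)` at the scales `N ≥ k n₀`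
divisible by `k`. -/
theorem stub_rswOfCertificates3_dualA :
    ∀ k : ℕ, k ≠ 0 → ∀ ρ c : ℝ,
      KSTPeriodic.Admissible k 1 ((selfRefinementMeasure k ρ c).map dualConfig) ∧
      ∀ (n₀ : ℕ) (ε : ℝ),
        (∀ n : ℕ, n₀ ≤ n →
          (selfRefinementMeasure k ρ c).real (KST2023.crossing (3 * (k * n)) (k * n)) ≤ 1 - ε) →
        ∀ N : ℕ, k * n₀ ≤ N → k ∣ N →
          ε ≤ ((selfRefinementMeasure k ρ c).map dualConfig).real (KSTPeriodic.crossing 1 N (8 * N)) := by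
  intro k hk ρ c
  -- `M_k(ρ, c)` is admissible with offset `0` (`flipEquiv 0 = reflectIso 0`)
  have hμ : KSTPeriodic.Admissible k 0 (selfRefinementMeasure k ρ c) :=
    { shift_inv := fun v => selfRefinementMeasure_map_relabel_shift hk ρ c v
      transpose_inv := selfRefinementMeasure_map_relabel_transpose k ρ c
      flip_inv := by
        have h : KSTPeriodic.flipEquiv 0 = (reflectIso (0 : Fin 2)).toEquiv := by
          refine Equiv.ext fun x => ?_
          ext j
          fin_cases j <;> simp
        rw [h]
        exact selfRefinementMeasure_map_relabel_reflect hk ρ c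
      posAssoc := isPositivelyAssociated_selfRefinementMeasure k ρ c }
  exact ⟨KSTPeriodic.admissible_map_dualConfig hμ, fun n₀ ε hcert =>
    RswCertDual.dual_shortWay (Nat.pos_of_ne_zero hk) hμ (selfRefinementMeasure_ae_subset_edgeSet k ρ c) hcert⟩

end Summit.CriticalPhenomena.CardyFormulaZ2.Cruxes.CriticalPathRSW.FiniteSizeEnvelope

end
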